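import Summits.CriticalPhenomena.Ising3DConformalLimit.Theorems.SynchronousCouplingRotationJoiningIsotropyMoments
import HarnessLib

/-!
# Route `SynchronousCoupling`, crux `RotationJoining` (stmt-CriticalPhenomena-18763), line `SketchIdeator2` (reshape 2) —
# the constrained smeared correlator is controlled by Cauchy–Schwarz (lead's tool for the near-field control)

For the critical state `μ`, cells `Pₗ ⊆ ℤ³` (`l ∈ Fin k`), two indices `a ≠ b` and a set `C ⊆ P_a × P_b` of CONSTRAINED pairs,
`Σ_{y ∈ ∏ Pₗ, (y_a, y_b) ∈ C} ⟨∏ₗ σ_{yₗ}⟩_{β_c} = E_μ[D · F]`, `D = Σ_{c ∈ C} σ_{c₁}σ_{c₂}`, `F = ∏_{l ∉ {a,b}} B(Pₗ)`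
(`integral_pairSum_mul_prod_eq_sum`), hence `≤ √E[D²] · √E[F²]` with
* `E[D²] = Σ_{c, c' ∈ C} ⟨σ_{c₁}σ_{c₂}σ_{c'₁}σ_{c'₂}⟩_{β_c}` (a CONSTRAINED four-point sum), and
* `E[F²] ≤ (2j)!/(2ʲ j!) · W^j`, `j = k − 2`, whenever every block has `E[B(Pₗ)²] ≤ W` and the state satisfies Newman's Gaussian
  bound for block spins (AM–GM `∏_{l∈L} B_l² ≤ (1/j) Σ_{l∈L} B_l^{2j}` and Newman termwise).
References: C. M. Newman, Z. Wahrsch. 33 (1975); M. Aizenman, H. Duminil-Copin, Ann. Math. 194 (2021) §6.3. No definitions, no sorry.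
-/

noncomputable section

namespace Summit.CriticalPhenomena.Ising3DConformalLimit.Cruxes.RotationJoining.RateSplitting

open MeasureTheory Filter Literature.Probability.LatticeModels
open scoped BigOperators

/-! ### Cauchy–Schwarz for bounded measurable real functions -/

/-- **Cauchy–Schwarz**: `|∫ D·F dμ| ≤ √(∫ D² dμ) · √(∫ F² dμ)` for bounded measurable real `D, F` on a finite measure space
(Hölder with `p = q = 2`). [folklore] -/
theorem abs_integral_mul_le_sqrt_mul_sqrt {Ω : Type*} [MeasurableSpace Ω] (μ : Measure Ω) [IsFiniteMeasure μ]
    {D F : Ω → ℝ} (hD : Measurable D) (hF : Measurable F) {bD bF : ℝ} (hbD : ∀ ω, |D ω| ≤ bD) (hbF : ∀ ω, |F ω| ≤ bF) :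
    |∫ ω, D ω * F ω ∂μ| ≤ Real.sqrt (∫ ω, D ω ^ 2 ∂μ) * Real.sqrt (∫ ω, F ω ^ 2 ∂μ) := by
  have hDm : MemLp D (ENNReal.ofReal 2) μ :=
    MemLp.of_bound hD.aestronglyMeasurable bD (Eventually.of_forall fun ω => by rw [Real.norm_eq_abs]; exact hbD ω)
  have hFm : MemLp F (ENNReal.ofReal 2) μ :=
    MemLp.of_bound hF.aestronglyMeasurable bF (Eventually.of_forall fun ω => by rw [Real.norm_eq_abs]; exact hbF ω)
  have h := integral_mul_norm_le_Lp_mul_Lq (μ := μ) Real.HolderConjugate.two_two hDm hFm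
  have e1 : ∀ G : Ω → ℝ, (∫ ω, ‖G ω‖ ^ (2:ℝ) ∂μ) ^ (1 / (2:ℝ)) = Real.sqrt (∫ ω, G ω ^ 2 ∂μ) := by
    intro G
    rw [Real.sqrt_eq_rpow]
    congr 1
    refine integral_congr_ae (Eventually.of_forall fun ω => ?_)
    simp only [Real.norm_eq_abs, Real.rpow_two, sq_abs]
  rw [e1 D, e1 F] at h
  calc |∫ ω, D ω * F ω ∂μ| ≤ ∫ ω, |D ω * F ω| ∂μ := abs_integral_le_integral_abs
    _ = ∫ ω, ‖D ω‖ * ‖F ω‖ ∂μ := by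
        refine integral_congr_ae (Eventually.of_forall fun ω => ?_)
        simp only [Real.norm_eq_abs, abs_mul]
    _ ≤ _ := h

/-! ### The square of the constrained pair sum -/

/-- `E_μ[(Σ_{c∈C} σ_{c₁}σ_{c₂})²] = Σ_{c,c' ∈ C} ⟨σ_{c₁}σ_{c₂}σ_{c'₁}σ_{c'₂}⟩_{β_c}` for a state with the plus correlations at `β_c`.
[cite: FriedliVelenik2017, Thm. 3.17 and Thm. 6.26] -/
theorem integral_sq_pairSum_eq {μ : Measure (SpinConfig (Site 3))} [IsFiniteMeasure μ]
    (hcorr : ∀ A : Finset (Site 3), spinCorr μ A = plusCorr 3 (criticalBeta 3) 0 A) (C : Finset (Site 3 × Site 3)) :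
    ∫ σ, (∑ c ∈ C, spinAt c.1 σ * spinAt c.2 σ) ^ 2 ∂μ =
      ∑ c ∈ C, ∑ c' ∈ C, criticalCorr 3 4 ![c.1, c.2, c'.1, c'.2] := by
  have hsq : ∀ σ : SpinConfig (Site 3), (∑ c ∈ C, spinAt c.1 σ * spinAt c.2 σ) ^ 2 =
      ∑ c ∈ C, ∑ c' ∈ C, spinMonomial ![c.1, c.2, c'.1, c'.2] σ := by
    intro σ
    rw [sq, Finset.sum_mul_sum]
    refine Finset.sum_congr rfl fun c _ => Finset.sum_congr rfl fun c' _ => ?_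
    simp only [spinMonomial, Fin.prod_univ_four, Matrix.cons_val_zero, Matrix.cons_val_one, Matrix.cons_val]
    ring
  simp_rw [hsq]
  rw [integral_finsetSum _ fun c _ => integrable_finsetSum _ fun c' _ => integrable_spinMonomial' μ _]
  refine Finset.sum_congr rfl fun c _ => ?_
  rw [integral_finsetSum _ fun c' _ => integrable_spinMonomial' μ _]
  exact Finset.sum_congr rfl fun c' _ => (criticalCorr_eq_integral_spinMonomial hcorr _).symm

/-! ### The square of the product of the free blocks -/

/-- AM–GM on a finite set: for `j = |L| ≥ 1` and reals `zₗ ≥ 0`, `∏_{l∈L} zₗ ≤ (1/j) Σ_{l∈L} zₗ^j`. [folklore] -/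
theorem prod_le_sum_pow_div {ι : Type*} (L : Finset ι) (hL : L.card ≠ 0) (z : ι → ℝ) (hz : ∀ l ∈ L, 0 ≤ z l) :
    ∏ l ∈ L, z l ≤ (∑ l ∈ L, z l ^ L.card) / L.card := by
  have hw : ∀ l ∈ L, (0 : ℝ) ≤ (L.card : ℝ)⁻¹ := fun _ _ => by positivity
  have hw' : ∑ _l ∈ L, (L.card : ℝ)⁻¹ = 1 := by
    rw [Finset.sum_const, nsmul_eq_mul, mul_inv_cancel₀]
    exact_mod_cast hL
  have h := Real.geom_mean_le_arith_mean_weighted L (fun _ => (L.card : ℝ)⁻¹) (fun l => z l ^ L.card) hw hw'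
    (fun l hl => pow_nonneg (hz l hl) _)
  have hlhs : ∏ l ∈ L, (z l ^ L.card) ^ ((L.card : ℝ)⁻¹) = ∏ l ∈ L, z l :=
    Finset.prod_congr rfl fun l hl => Real.pow_rpow_inv_natCast (hz l hl) hL
  rw [hlhs] at h
  calc ∏ l ∈ L, z l ≤ ∑ l ∈ L, (L.card : ℝ)⁻¹ * z l ^ L.card := h
    _ = (∑ l ∈ L, z l ^ L.card) / L.card := by rw [← Finset.mul_sum, div_eq_inv_mul]

/-- **The free blocks: `E[F²] ≤ (2j)!/(2ʲj!) · W^j`**, `F = ∏ₗ (if l ∈ {a,b} then 1 else B(Pₗ))`, `j = k − 2`, for a probability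
measure whose block spins obey Newman's Gaussian bound and have second moments `≤ W`. [cite: AizenmanDuminilCopinAnnals2021, arXiv:1912.07973 §6.3] -/
theorem integral_sq_prod_free_blocks_le {μ : Measure (SpinConfig (Site 3))} [IsProbabilityMeasure μ]
    (hNB : ∀ (S : Finset (Site 3)) (j : ℕ), ∫ σ, (blockSum S σ) ^ (2 * j) ∂μ ≤
      ((2 * j).factorial : ℝ) / (2 ^ j * j.factorial) * (∫ σ, (blockSum S σ) ^ 2 ∂μ) ^ j)
    {k : ℕ} (P : Fin k → Finset (Site 3)) {a b : Fin k} (hab : a ≠ b) {W : ℝ}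
    (hW : ∀ l, ∫ σ, (blockSum (P l) σ) ^ 2 ∂μ ≤ W) :
    ∫ σ, (∏ l, (if l = a ∨ l = b then (1:ℝ) else blockSum (P l) σ)) ^ 2 ∂μ ≤
      ((2 * (k - 2)).factorial : ℝ) / (2 ^ (k - 2) * (k - 2).factorial) * W ^ (k - 2) := by
  classical
  -- the set of free indices
  set L : Finset (Fin k) := Finset.univ.filter (fun l => ¬(l = a ∨ l = b)) with hL
  have hLcard : L.card = k - 2 := by
    have h1 : (Finset.univ.filter (fun l : Fin k => l = a ∨ l = b)) = {a, b} := by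
      ext l; simp
    have h2 := Finset.card_filter_add_card_filter_not (s := Finset.univ) (fun l : Fin k => l = a ∨ l = b)
    rw [h1, Finset.card_pair hab, Finset.card_univ, Fintype.card_fin] at h2
    rw [hL]; omega
  -- the squared product is the product of squares over `L`
  have hprod : ∀ σ : SpinConfig (Site 3), (∏ l, (if l = a ∨ l = b then (1:ℝ) else blockSum (P l) σ)) ^ 2 =
      ∏ l ∈ L, blockSum (P l) σ ^ 2 := by
    intro σ
    have h1 : ∏ l ∈ Finset.univ.filter (fun l : Fin k => l = a ∨ l = b),
        (if l = a ∨ l = b then (1:ℝ) else blockSum (P l) σ) ^ 2 = 1 :=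
      Finset.prod_eq_one fun l hl => by
        rw [Finset.mem_filter] at hl
        rw [if_pos hl.2, one_pow]
    have h2 : ∏ l ∈ Finset.univ.filter (fun l : Fin k => ¬(l = a ∨ l = b)),
        (if l = a ∨ l = b then (1:ℝ) else blockSum (P l) σ) ^ 2 = ∏ l ∈ L, blockSum (P l) σ ^ 2 :=
      Finset.prod_congr rfl fun l hl => by
        rw [Finset.mem_filter] at hl
        rw [if_neg hl.2]
    rw [← Finset.prod_pow, ← Finset.prod_filter_mul_prod_filter_not Finset.univ (fun l : Fin k => l = a ∨ l = b),
      h1, h2, one_mul]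
  simp_rw [hprod]
  -- case `k = 2`: empty product
  rcases Nat.eq_zero_or_pos (k - 2) with hk | hk
  · have hLe : L = ∅ := Finset.card_eq_zero.1 (by rw [hLcard, hk])
    rw [hLe, hk]
    simp
  -- case `j = k - 2 ≥ 1`: AM–GM then Newman
  set j := k - 2 with hj
  have hLne : L.card ≠ 0 := by rw [hLcard]; omega
  have hpt : ∀ σ : SpinConfig (Site 3), ∏ l ∈ L, blockSum (P l) σ ^ 2 ≤
      (∑ l ∈ L, blockSum (P l) σ ^ (2 * j)) / j := by
    intro σ
    have h := prod_le_sum_pow_div L hLne (fun l => blockSum (P l) σ ^ 2) (fun l _ => sq_nonneg _)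
    rw [hLcard] at h
    simpa only [← pow_mul] using h
  -- integrability of everything (bounded measurable functions on a probability space)
  have hmeas : ∀ (S : Finset (Site 3)), Measurable (blockSum S) := fun S =>
    Finset.measurable_sum _ fun x _ => measurable_spinAt x
  have hbdd : ∀ (S : Finset (Site 3)) (σ : SpinConfig (Site 3)), |blockSum S σ| ≤ S.card := fun S σ => by
    calc |blockSum S σ| ≤ ∑ x ∈ S, |spinAt x σ| := Finset.abs_sum_le_sum_abs _ _
      _ = ∑ _x ∈ S, (1:ℝ) := Finset.sum_congr rfl fun x _ => abs_spinAt x σ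
      _ = S.card := by simp
  have hint : ∀ (S : Finset (Site 3)) (q : ℕ), Integrable (fun σ => blockSum S σ ^ q) μ := fun S q =>
    Integrable.of_bound ((hmeas S).pow_const q).aestronglyMeasurable ((S.card : ℝ) ^ q)
      (Eventually.of_forall fun σ => by
        rw [Real.norm_eq_abs, abs_pow]; exact pow_le_pow_left₀ (abs_nonneg _) (hbdd S σ) q)
  have hintL : Integrable (fun σ => ∏ l ∈ L, blockSum (P l) σ ^ 2) μ := by
    refine Integrable.of_bound ?_ (∏ l ∈ L, ((P l).card : ℝ) ^ 2) (Eventually.of_forall fun σ => ?_)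
    · exact (Finset.measurable_prod _ fun l _ => (hmeas (P l)).pow_const 2).aestronglyMeasurable
    · rw [Real.norm_eq_abs, Finset.abs_prod]
      refine Finset.prod_le_prod (fun l _ => abs_nonneg _) fun l _ => ?_
      rw [abs_pow]; exact pow_le_pow_left₀ (abs_nonneg _) (hbdd _ σ) 2
  calc ∫ σ, ∏ l ∈ L, blockSum (P l) σ ^ 2 ∂μ
      ≤ ∫ σ, (∑ l ∈ L, blockSum (P l) σ ^ (2 * j)) / j ∂μ :=
        integral_mono hintL ((integrable_finsetSum _ fun l _ => hint (P l) (2 * j)).div_const _) hpt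
    _ = (∑ l ∈ L, ∫ σ, blockSum (P l) σ ^ (2 * j) ∂μ) / j := by
        rw [integral_div, integral_finsetSum _ fun l _ => hint (P l) (2 * j)]
    _ ≤ (∑ _l ∈ L, ((2 * j).factorial : ℝ) / (2 ^ j * j.factorial) * W ^ j) / j := by
        refine div_le_div_of_nonneg_right (Finset.sum_le_sum fun l _ => (hNB (P l) j).trans ?_) (by positivity)
        refine mul_le_mul_of_nonneg_left (pow_le_pow_left₀ (integral_nonneg fun σ => ?_) (hW l) j)
          (by positivity)
        exact sq_nonneg _
    _ = ((2 * j).factorial : ℝ) / (2 ^ j * j.factorial) * W ^ j := by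
        rw [Finset.sum_const, hLcard, nsmul_eq_mul]
        have hj0 : (j : ℝ) ≠ 0 := by exact_mod_cast (show j ≠ 0 by omega)
        field_simp

/-! ### The constrained smeared correlator -/

/-- **Constrained smeared correlators are controlled by Cauchy–Schwarz.** For the critical state `μ` (plus correlations,
Newman's bound for block spins), cells `Pₗ` with `E[B(Pₗ)²] ≤ W`, indices `a ≠ b` and constrained pairs `C ⊆ P_a × P_b`:
`Σ_{y ∈ ∏ Pₗ, (y_a,y_b) ∈ C} ⟨∏ₗ σ_{yₗ}⟩_{β_c} ≤ √(Σ_{c,c'∈C} ⟨σ_{c₁}σ_{c₂}σ_{c'₁}σ_{c'₂}⟩) · √((2j)!/(2ʲ j!) W^j)`,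
`j = k − 2`. [cite: AizenmanDuminilCopinAnnals2021, arXiv:1912.07973 §6.3] -/
theorem constrainedSum_le_sqrt_mul_sqrt {μ : Measure (SpinConfig (Site 3))} [IsProbabilityMeasure μ]
    (hcorr : ∀ A : Finset (Site 3), spinCorr μ A = plusCorr 3 (criticalBeta 3) 0 A)
    (hNB : ∀ (S : Finset (Site 3)) (j : ℕ), ∫ σ, (blockSum S σ) ^ (2 * j) ∂μ ≤
      ((2 * j).factorial : ℝ) / (2 ^ j * j.factorial) * (∫ σ, (blockSum S σ) ^ 2 ∂μ) ^ j)
    {k : ℕ} (P : Fin k → Finset (Site 3)) {a b : Fin k} (hab : a ≠ b)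
    (C : Finset (Site 3 × Site 3)) (hC : C ⊆ P a ×ˢ P b) {W : ℝ}
    (hW : ∀ l, ∫ σ, (blockSum (P l) σ) ^ 2 ∂μ ≤ W) :
    ∑ y ∈ (Fintype.piFinset P).filter (fun y => (y a, y b) ∈ C), criticalCorr 3 k y ≤
      Real.sqrt (∑ c ∈ C, ∑ c' ∈ C, criticalCorr 3 4 ![c.1, c.2, c'.1, c'.2]) *
        Real.sqrt (((2 * (k - 2)).factorial : ℝ) / (2 ^ (k - 2) * (k - 2).factorial) * W ^ (k - 2)) := by
  classical
  rw [← integral_pairSum_mul_prod_eq_sum hcorr P hab C hC, ← integral_sq_pairSum_eq hcorr C]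
  -- measurability and bounds
  have hmeas : ∀ (S : Finset (Site 3)), Measurable (blockSum S) := fun S =>
    Finset.measurable_sum _ fun x _ => measurable_spinAt x
  have hbdd : ∀ (S : Finset (Site 3)) (σ : SpinConfig (Site 3)), |blockSum S σ| ≤ S.card := fun S σ => by
    calc |blockSum S σ| ≤ ∑ x ∈ S, |spinAt x σ| := Finset.abs_sum_le_sum_abs _ _
      _ = ∑ _x ∈ S, (1:ℝ) := Finset.sum_congr rfl fun x _ => abs_spinAt x σ
      _ = S.card := by simp
  have hDm : Measurable fun σ : SpinConfig (Site 3) => ∑ c ∈ C, spinAt c.1 σ * spinAt c.2 σ :=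
    Finset.measurable_sum _ fun c _ => (measurable_spinAt c.1).mul (measurable_spinAt c.2)
  have hDb : ∀ σ : SpinConfig (Site 3), |∑ c ∈ C, spinAt c.1 σ * spinAt c.2 σ| ≤ C.card := fun σ => by
    calc |∑ c ∈ C, spinAt c.1 σ * spinAt c.2 σ| ≤ ∑ c ∈ C, |spinAt c.1 σ * spinAt c.2 σ| :=
          Finset.abs_sum_le_sum_abs _ _
      _ = ∑ _c ∈ C, (1:ℝ) := Finset.sum_congr rfl fun c _ => by rw [abs_mul, abs_spinAt, abs_spinAt, mul_one]
      _ = C.card := by simp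
  have hFm : Measurable fun σ : SpinConfig (Site 3) => ∏ l, (if l = a ∨ l = b then (1:ℝ) else blockSum (P l) σ) := by
    refine Finset.measurable_prod _ fun l _ => ?_
    by_cases h : l = a ∨ l = b
    · simp only [if_pos h]; exact measurable_const
    · simp only [if_neg h]; exact hmeas _
  have hFb : ∀ σ : SpinConfig (Site 3), |∏ l, (if l = a ∨ l = b then (1:ℝ) else blockSum (P l) σ)| ≤
      ∏ l : Fin k, (((P l).card : ℝ) + 1) := fun σ => by
    rw [Finset.abs_prod]
    refine Finset.prod_le_prod (fun l _ => abs_nonneg _) fun l _ => ?_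
    by_cases h : l = a ∨ l = b
    · rw [if_pos h, abs_one]; linarith [Nat.cast_nonneg (α := ℝ) (P l).card]
    · rw [if_neg h]; linarith [hbdd (P l) σ]
  refine (le_abs_self _).trans ((abs_integral_mul_le_sqrt_mul_sqrt μ hDm hFm hDb hFb).trans ?_)
  gcongr
  exact integral_sq_prod_free_blocks_le hNB P hab hW

end Summit.CriticalPhenomena.Ising3DConformalLimit.Cruxes.RotationJoining.RateSplitting

end
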